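import Summits.HodgeConjecture.HodgeConjecture.Theorems.PeriodDeficiencyQbarGenericIsHodgeGenericSpecialCountableEnvelope
import Summits.HodgeConjecture.HodgeConjecture.Theorems.PeriodDeficiencyQbarGenericIsHodgeGenericStubIrredClosedHasMaximal
import Mathlib.AlgebraicGeometry.Noetherian
import HarnessLib

/-!
# Crux `QbarGenericIsHodgeGeneric` (stmt-HodgeConjecture-11595), line `registered`, reshape r5 (lead c2):
# stub (iv'-c) `stub_countable_special_of_cover` — the descent

The registered stub (iv'-c) of the line skeleton `Cruxes/QbarGenericIsHodgeGeneric/Lines/birth.lean`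
(reshape r5), proved UNCONDITIONALLY: it is pure topology / order theory on the tree's carriers
`ZariskiPoints`, `IsIrredComponentOnPoints`, `VHSData.IsSpecialSubvariety`
(`Literature/AlgebraicGeometry/Motives/AtypicalHodgeLocus`).

**Statement.** Let `S` be a smooth `ℂ`-scheme, `D` a VHS datum on `S(ℂ)` with bounded pointwise
Mumford–Tate ranks, `U ⊆ S` an affine open. Assume
(F1) for every irreducible Zariski-closed `Z ⊆ S(ℂ)` meeting `U(ℂ)` there are countably many
Zariski-closed `W k ⊉ Z` containing every point of `Z` over `U` of Mumford–Tate rank `< genericMTRank Z`;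
(F2) an irreducible Zariski-closed `Y` meeting `U(ℂ)` whose points over `U` are covered by countably
many Zariski-closed sets lies in one of them.
Then the special subvarieties of `S` for `D` (`VHSData.IsSpecialSubvariety`, Baldi–Klingler–Ullmo
2024, Def. 3.3 / Lemma 3.6) meeting `U(ℂ)` are countably many.

**Proof.** Fix the covers `W_Z` of (F1) as a function of `Z`. For `Z` irreducible closed meeting `U`
let `children Z` be the irreducible components of the closed sets `Z ∩ W_Z k` (`k ∈ ℕ`) meeting
`U(ℂ)`: countably many (`countable_irredComponentsOnPoints_meeting_affineOpen`, p156228). Put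
`T 0 :=` the components of `S(ℂ)` meeting `U(ℂ)` and `T (m+1) := ⋃ Z ∈ T m, children Z`; all `T m`
are countable. KEY STEP (`exists_child_of_isSpecialSubvariety`): if `Y` is special, meets `U`, and
`Y ⊊ Z` with `Z` irreducible closed, then `genericMTRank Y < genericMTRank Z` (specialness), so every
point of `Y` over `U` has rank `≤ genericMTRank Y < genericMTRank Z` and lies in some `W_Z k` (F1);
by (F2) `Y ⊆ W_Z k₀` for one `k₀`, so `Y ⊆ Z ∩ W_Z k₀` lies in an irreducible component `Z'` of it
(Zorn: `exists_isIrredComponentOnPoints_superset`), and `Z' ⊊ Z` because `Z ⊄ W_Z k₀`. Hence, by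
well-founded induction along STRICT INCLUSION of irreducible closed sets meeting `U(ℂ)` — well
founded because the points over `U` form a Noetherian open subspace `V` of `ZariskiPoints S ℂ`
(`U` is a Noetherian space: `S` smooth ⟹ locally Noetherian, `U` affine) and
`Z ↦ closure (Z ∩ V) ∈ Closeds V` is strictly monotone on irreducible closed sets meeting `V`
(`Z = closure (Z ∩ V)`) — every special `Y` meeting `U` inside some `Z ∈ T m` lies in some `T m'`;
start from a component of `S(ℂ)` containing `Y`.

Everything used is proved in Mathlib or in the tree (p156228); no named fact is assumed.

## References

* G. Baldi, B. Klingler, E. Ullmo, On the distribution of the Hodge locus, Invent. Math. 235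
  (2024), §3.4 and Lemma 3.6. [BaldiKlinglerUllmo2024]
* E. Cattani, P. Deligne, A. Kaplan, On the locus of Hodge classes, JAMS 8 (1995), Thm. 1.1, Cor. 1.2
  (the source of (F1) for geometric variations; not used in this file).
-/

noncomputable section

-- every declaration of this problem lives in `Summit.HodgeConjecture.HodgeConjecture.…` (problem = summit)
set_option linter.dupNamespace false

open CategoryTheory AlgebraicGeometry Literature.AlgebraicGeometry.Motives
open _root_.Topology TopologicalSpace

namespace Summit.HodgeConjecture.HodgeConjecture.Theorems

/-! ### Pure topology: maximal irreducible subsets, strictness of traces on an open set -/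

/-- The union of a chain (for `⊆`) of preirreducible sets is preirreducible (the argument inside
Mathlib's `exists_preirreducible`). [folklore] -/
theorem isPreirreducible_sUnion_of_isChain {X : Type*} [TopologicalSpace X] {c : Set (Set X)}
    (hc : ∀ t ∈ c, IsPreirreducible t) (hcc : IsChain (· ⊆ ·) c) : IsPreirreducible (⋃₀ c) := by
  rintro u v hu hv ⟨y, hy, hyu⟩ ⟨x, hx, hxv⟩
  obtain ⟨p, hpc, hyp⟩ := Set.mem_sUnion.1 hy
  obtain ⟨q, hqc, hxq⟩ := Set.mem_sUnion.1 hx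
  rcases hcc.total hpc hqc with hpq | hqp
  · obtain ⟨z, hzq, hzuv⟩ := hc q hqc u v hu hv ⟨y, hpq hyp, hyu⟩ ⟨x, hxq, hxv⟩
    exact ⟨z, Set.subset_sUnion_of_mem hqc hzq, hzuv⟩
  · obtain ⟨z, hzp, hzuv⟩ := hc p hpc u v hu hv ⟨y, hyp, hyu⟩ ⟨x, hqp hxq, hxv⟩
    exact ⟨z, Set.subset_sUnion_of_mem hpc hzp, hzuv⟩

/-- **An irreducible subset of a closed set lies in a maximal irreducible closed subset of it**
(an "irreducible component of `A` containing `Y`"): Zorn on the preirreducible subsets of `A`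
containing `Y`; a maximal one is irreducible, closed (its closure is again preirreducible and inside
the closed `A`) and maximal among all irreducible subsets of `A`. [folklore] -/
theorem exists_maximal_isIrreducible_subset {X : Type*} [TopologicalSpace X] {A Y : Set X}
    (hA : IsClosed A) (hY : IsIrreducible Y) (hYA : Y ⊆ A) :
    ∃ M : Set X, IsClosed M ∧ IsIrreducible M ∧ Y ⊆ M ∧ M ⊆ A ∧
      ∀ M' : Set X, IsIrreducible M' → M ⊆ M' → M' ⊆ A → M' = M := by
  obtain ⟨M, hYM, hM⟩ := zorn_subset_nonempty {t : Set X | IsPreirreducible t ∧ t ⊆ A}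
    (fun c hcS hcc _ => ⟨⋃₀ c,
      ⟨isPreirreducible_sUnion_of_isChain (fun t ht => (hcS ht).1) hcc,
        Set.sUnion_subset fun t ht => (hcS ht).2⟩,
      fun _ ht => Set.subset_sUnion_of_mem ht⟩) Y ⟨hY.isPreirreducible, hYA⟩
  have hMc : IsClosed M := by
    rw [← closure_eq_iff_isClosed]
    exact (hM.eq_of_subset ⟨hM.prop.1.closure, closure_minimal hM.prop.2 hA⟩ subset_closure).symm
  exact ⟨M, hMc, ⟨hY.nonempty.mono hYM, hM.prop.1⟩, hYM, hM.prop.2,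
    fun M' hM' hMM' hM'A => (hM.eq_of_subset ⟨hM'.isPreirreducible, hM'A⟩ hMM').symm⟩

/-- **Traces on an open set separate irreducible closed sets meeting it, strictly.** In a space `X`
with an open `V`, if `A ⊊ B` with `A` closed meeting `V` and `B` preirreducible, then the closures in
`V` of the traces satisfy `closure (A ∩ V) < closure (B ∩ V)` in `Closeds V`: were they equal,
`B ⊆ closure (B ∩ V)` (Mathlib `subset_closure_inter_of_isPreirreducible_of_isOpen`) would lie in
the closed `A`. [folklore] -/
theorem closure_preimage_val_lt_of_ssubset {X : Type*} [TopologicalSpace X] {V : Set X}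
    (hV : IsOpen V) {A B : Set X} (hA : IsClosed A) (hB : IsPreirreducible B) (hAB : A ⊂ B)
    (hAV : (A ∩ V).Nonempty) :
    Closeds.closure ((Subtype.val : V → X) ⁻¹' A) < Closeds.closure ((Subtype.val : V → X) ⁻¹' B) := by
  refine lt_of_le_not_ge (Closeds.gc.monotone_l (Set.preimage_mono hAB.le)) fun hle => hAB.2 ?_
  obtain ⟨a, haA, haV⟩ := hAV
  refine (subset_closure_inter_of_isPreirreducible_of_isOpen hB hV ⟨a, hAB.le haA, haV⟩).trans
    (closure_minimal ?_ hA)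
  rintro x ⟨hxB, hxV⟩
  have hx : (⟨x, hxV⟩ : V) ∈ Closeds.closure ((Subtype.val : V → X) ⁻¹' B) :=
    Closeds.mem_closure.2 (subset_closure hxB)
  have hx' := Closeds.mem_closure.1 (hle hx)
  rw [(hA.preimage continuous_subtype_val).closure_eq] at hx'
  exact hx'

/-! ### On the tree's carriers: components containing a given irreducible set, Noetherian charts -/

/-- **An irreducible Zariski-closed set of points inside a Zariski-closed `A` lies in an irreducible
component of `A`** (`IsIrredComponentOnPoints`): `exists_maximal_isIrreducible_subset` on
`ZariskiPoints S ℂ`, transported along the identity `ZariskiPoints.val` (`zariskiSet_image_val`,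
`zariskiSet_injective`). [folklore] -/
theorem exists_isIrredComponentOnPoints_superset {S : SchemeOver ℂ} {A Y : Set (ComplexPoints S)}
    (hA : IsZariskiClosedOnPoints S A) (hY : IsIrreducibleZariskiClosedOnPoints S Y) (hYA : Y ⊆ A) :
    ∃ Y' : Set (ComplexPoints S), IsIrredComponentOnPoints S A Y' ∧ Y ⊆ Y' := by
  have hAc : IsClosed (zariskiSet S A) := (isZariskiClosedOnPoints_iff_isClosed A).1 hA
  obtain ⟨M, hMc, hMi, hYM, hMA, hMmax⟩ :=
    exists_maximal_isIrreducible_subset hAc hY.2 (Set.preimage_mono hYA)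
  refine ⟨ZariskiPoints.val '' M, ⟨?_, ?_, fun Y' hY' hMY' hY'A => ?_⟩, fun P hP => ?_⟩
  · show IsClosed (zariskiSet S (ZariskiPoints.val '' M)) ∧
      IsIrreducible (zariskiSet S (ZariskiPoints.val '' M))
    rw [zariskiSet_image_val]
    exact ⟨hMc, hMi⟩
  · rintro _ ⟨Q, hQ, rfl⟩
    exact hMA hQ
  · -- maximality: `zariskiSet S Y' = M`
    apply zariskiSet_injective S
    rw [zariskiSet_image_val]
    refine hMmax _ hY'.2 (fun Q hQ => ?_) (Set.preimage_mono hY'A)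
    exact hMY' ⟨Q, hQ, rfl⟩
  · exact ⟨(show ZariskiPoints S ℂ from P), hYM (show (show ZariskiPoints S ℂ from P) ∈
      zariskiSet S Y from hP), rfl⟩

/-- **The complex points over an affine open of a smooth `ℂ`-scheme form a Noetherian subspace of
`ZariskiPoints S ℂ`.** `S` smooth over `ℂ` ⟹ locally of finite type ⟹ locally Noetherian
(Mathlib `LocallyOfFiniteType.isLocallyNoetherian`), so the affine open `U` is a Noetherian space
(`noetherianSpace_of_isAffineOpen`), and the points over `U` carry the topology induced from `U`
(the construction inside `finite_irredComponentsOnPoints_meeting_affineOpen`, p156228). [folklore] -/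
theorem noetherianSpace_zariskiPoints_over {S : SchemeOver ℂ} (hsm : AlgebraicGeometry.Smooth S.hom)
    (U : S.left.Opens) (hU : IsAffineOpen U) :
    NoetherianSpace ↥((fun P : ZariskiPoints S ℂ => P.val.pt) ⁻¹' (U : Set S.left)) := by
  haveI := hsm
  haveI : IsLocallyNoetherian S.left := LocallyOfFiniteType.isLocallyNoetherian S.hom
  haveI : IsNoetherianRing Γ(S.left, U) := IsLocallyNoetherian.component_noetherian ⟨U, hU⟩
  haveI hUsch : NoetherianSpace (U : Scheme) := noetherianSpace_of_isAffineOpen U hU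
  haveI : NoetherianSpace (U : Set S.left) := by
    have h := NoetherianSpace.range U.ι.base U.ι.base.hom.continuous
    rwa [Scheme.Opens.range_ι] at h
  have hind : IsInducing (fun P : ZariskiPoints S ℂ => P.val.pt) := ⟨rfl⟩
  let g : ↥((fun P : ZariskiPoints S ℂ => P.val.pt) ⁻¹' (U : Set S.left)) → U :=
    fun P => ⟨P.1.val.pt, P.2⟩
  have hg : IsInducing g := by
    rw [← IsInducing.subtypeVal.of_comp_iff]
    exact hind.comp IsInducing.subtypeVal
  exact hg.noetherianSpace

/-- **Strict inclusion of irreducible Zariski-closed sets of points meeting an affine chart is well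
founded** (the descending chain condition used for the descent): pull back the well-founded `<` on
`Closeds V`, `V` = the Noetherian subspace of points over `U` (`noetherianSpace_zariskiPoints_over`),
along `Z ↦ closure (Z ∩ V)`, which is strictly monotone on irreducible closed sets meeting `V`
(`closure_preimage_val_lt_of_ssubset`). [folklore] -/
theorem wellFounded_ssubset_irreducibleZariskiClosedOnPoints {S : SchemeOver ℂ}
    (hsm : AlgebraicGeometry.Smooth S.hom) (U : S.left.Opens) (hU : IsAffineOpen U) :
    WellFounded fun Z' Z : Set (ComplexPoints S) => Z' ⊂ Z ∧ IsIrreducibleZariskiClosedOnPoints S Z' ∧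
      IsIrreducibleZariskiClosedOnPoints S Z ∧ ∃ z ∈ Z', z.pt ∈ U := by
  haveI := noetherianSpace_zariskiPoints_over hsm U hU
  have hind : IsInducing (fun P : ZariskiPoints S ℂ => P.val.pt) := ⟨rfl⟩
  have hV : IsOpen ((fun P : ZariskiPoints S ℂ => P.val.pt) ⁻¹' (U : Set S.left)) :=
    hind.continuous.isOpen_preimage _ U.isOpen
  refine (InvImage.wf (fun Z : Set (ComplexPoints S) => Closeds.closure
    ((Subtype.val : ↥((fun P : ZariskiPoints S ℂ => P.val.pt) ⁻¹' (U : Set S.left)) →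
      ZariskiPoints S ℂ) ⁻¹' zariskiSet S Z)) wellFounded_lt).mono fun Z' Z h => ?_
  obtain ⟨hss, hZ', hZ, z, hz, hzU⟩ := h
  refine closure_preimage_val_lt_of_ssubset hV hZ'.1 hZ.2.isPreirreducible
    ⟨Set.preimage_mono hss.le, fun h => hss.2 fun P hP => ?_⟩
    ⟨(show ZariskiPoints S ℂ from z), hz, hzU⟩
  exact h (show (show ZariskiPoints S ℂ from P) ∈ zariskiSet S Z from hP)

/-! ### The key step and the descent -/

/-- **KEY STEP of the descent (BKU Lemma 3.6 + the covers).** Let `Z` be irreducible Zariski-closed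
with a countable family of Zariski-closed `W k ⊉ Z` containing every point of `Z` over `U` of
Mumford–Tate rank `< genericMTRank Z`, and let `Y ⊊ Z` be special such that `Y` lies in one member of
any countable Zariski-closed cover of its points over `U`. Then `Y` lies in an irreducible component
`Z' ⊊ Z` of some `Z ∩ W k`: `genericMTRank Y < genericMTRank Z` (specialness), every `y ∈ Y` over `U`
has `mtRankAt y ≤ genericMTRank Y` (bounded ranks), hence lies in some `W k`; so `Y ⊆ W k₀`, and
`Y ⊆ Z ∩ W k₀` lies in a component `Z'` of it (`exists_isIrredComponentOnPoints_superset`), with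
`Z' ≠ Z` as `Z ⊄ W k₀`. [cite: BaldiKlinglerUllmo2024, §3.4 and Lemma 3.6] -/
theorem exists_child_of_isSpecialSubvariety [HodgeTensorFacts.{0, 0}] {S : SchemeOver ℂ} {w : ℤ}
    (D : VHSData (ComplexPoints S) w) [∀ s, Module.Finite ℚ (D.V.fiber s)]
    (hbdd : BddAbove (Set.range fun s : ComplexPoints S => D.mtRankAt s))
    {U : S.left.Opens} {Z : Set (ComplexPoints S)} (hZ : IsIrreducibleZariskiClosedOnPoints S Z)
    (W : ℕ → Set (ComplexPoints S)) (hW₁ : ∀ k, IsZariskiClosedOnPoints S (W k) ∧ ¬ Z ⊆ W k)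
    (hW₂ : ∀ z ∈ Z, z.pt ∈ U → D.mtRankAt z < D.genericMTRank Z → ∃ k, z ∈ W k)
    {Y : Set (ComplexPoints S)} (hY : D.IsSpecialSubvariety Y)
    (hF2Y : ∀ W' : ℕ → Set (ComplexPoints S), (∀ k, IsZariskiClosedOnPoints S (W' k)) →
      (∀ y ∈ Y, y.pt ∈ U → ∃ k, y ∈ W' k) → ∃ k, Y ⊆ W' k)
    (hYZ : Y ⊆ Z) (hne : Y ≠ Z) :
    ∃ (k : ℕ) (Z' : Set (ComplexPoints S)),
      IsIrredComponentOnPoints S (Z ∩ W k) Z' ∧ Y ⊆ Z' ∧ Z' ⊂ Z := by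
  have hlt : D.genericMTRank Y < D.genericMTRank Z := hY.2 Z hZ (hYZ.ssubset_of_ne hne)
  have hbY : BddAbove (Set.range fun y : Y => D.mtRankAt y) := by
    obtain ⟨M, hM⟩ := hbdd
    exact ⟨M, by rintro _ ⟨y, rfl⟩; exact hM ⟨y, rfl⟩⟩
  obtain ⟨k, hk⟩ := hF2Y W (fun k => (hW₁ k).1) fun y hy hyU =>
    hW₂ y (hYZ hy) hyU ((D.mtRankAt_le_genericMTRank hbY hy).trans_lt hlt)
  have hA : IsZariskiClosedOnPoints S (Z ∩ W k) :=
    ((isZariskiClosedOnPoints_iff_isClosed Z).2 hZ.1).inter (hW₁ k).1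
  obtain ⟨Z', hZ', hYZ'⟩ := exists_isIrredComponentOnPoints_superset hA hY.1 (Set.subset_inter hYZ hk)
  refine ⟨k, Z', hZ', hYZ', (hZ'.2.1.trans Set.inter_subset_left).ssubset_of_ne ?_⟩
  rintro rfl
  exact (hW₁ k).2 (hZ'.2.1.trans Set.inter_subset_right)

/-- STUB (iv'-c) — **descent: the special subvarieties meeting an affine chart are countably many,
given countable strict-closed covers of the non-generic loci and the uncountability lemma.** For a
VHS datum `D` on `S(ℂ)` (`S` smooth over `ℂ`) with bounded Mumford–Tate ranks, an affine open `U`,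
(F1) for every irreducible Zariski-closed `Z` meeting `U(ℂ)` countably many Zariski-closed `W k ⊉ Z`
containing the points of `Z` over `U` of rank `< genericMTRank Z`, and (F2) irreducible Zariski-closed
sets meeting `U(ℂ)` covered over `U` by countably many Zariski-closed sets lie in one of them: the
special subvarieties (`VHSData.IsSpecialSubvariety`, BKU Lemma 3.6) meeting `U(ℂ)` are countably
many. Proof: with `T 0` = the components of `S(ℂ)` meeting `U(ℂ)` and `T (m+1)` = the components
meeting `U(ℂ)` of the `Z ∩ W_Z k`, `Z ∈ T m` (all countable:
`countable_irredComponentsOnPoints_meeting_affineOpen`), every special `Y` meeting `U(ℂ)` lies in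
some `T m`, by well-founded induction along strict inclusion of irreducible closed sets meeting the
Noetherian chart (`wellFounded_ssubset_irreducibleZariskiClosedOnPoints`) using the key step
`exists_child_of_isSpecialSubvariety`. [cite: BaldiKlinglerUllmo2024, §3.4 and Lemma 3.6] -/
theorem stub_countable_special_of_cover :
    ∀ [HodgeTensorFacts.{0, 0}] ⦃S : SchemeOver ℂ⦄ ⦃w : ℤ⦄ (D : VHSData (ComplexPoints S) w)
      [∀ s, Module.Finite ℚ (D.V.fiber s)],
      AlgebraicGeometry.Smooth S.hom → ∀ (U : S.left.Opens), IsAffineOpen U →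
      BddAbove (Set.range fun s : ComplexPoints S => D.mtRankAt s) →
      (∀ Z : Set (ComplexPoints S), IsIrreducibleZariskiClosedOnPoints S Z → (∃ z ∈ Z, z.pt ∈ U) →
        ∃ W : ℕ → Set (ComplexPoints S), (∀ k, IsZariskiClosedOnPoints S (W k) ∧ ¬ Z ⊆ W k) ∧
          ∀ z ∈ Z, z.pt ∈ U → D.mtRankAt z < D.genericMTRank Z → ∃ k, z ∈ W k) →
      (∀ Y : Set (ComplexPoints S), IsIrreducibleZariskiClosedOnPoints S Y → (∃ y ∈ Y, y.pt ∈ U) →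
        ∀ W : ℕ → Set (ComplexPoints S), (∀ k, IsZariskiClosedOnPoints S (W k)) →
          (∀ y ∈ Y, y.pt ∈ U → ∃ k, y ∈ W k) → ∃ k, Y ⊆ W k) →
      {Y : Set (ComplexPoints S) | D.IsSpecialSubvariety Y ∧ ∃ y ∈ Y, y.pt ∈ U}.Countable := by
  intro _ S w D _ hsm U hU hbdd hF1 hF2
  -- (0) the covers of (F1) as a function `W Z` of `Z`
  choose! W hW₁ hW₂ using hF1
  -- (1) one-step children of an irreducible closed `Z` meeting `U`: components of the `Z ∩ W Z k`
  obtain ⟨children, hch⟩ : ∃ children : Set (ComplexPoints S) → Set (Set (ComplexPoints S)),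
      ∀ Z Z', Z' ∈ children Z ↔
        (∃ k, IsIrredComponentOnPoints S (Z ∩ W Z k) Z') ∧ ∃ y ∈ Z', y.pt ∈ U :=
    ⟨fun Z => {Z' | (∃ k, IsIrredComponentOnPoints S (Z ∩ W Z k) Z') ∧ ∃ y ∈ Z', y.pt ∈ U},
      fun _ _ => Iff.rfl⟩
  have hchc : ∀ Z, IsIrreducibleZariskiClosedOnPoints S Z → (∃ z ∈ Z, z.pt ∈ U) →
      (children Z).Countable := by
    intro Z hZ hZU
    have hZc : IsZariskiClosedOnPoints S Z := (isZariskiClosedOnPoints_iff_isClosed Z).2 hZ.1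
    refine (countable_irredComponentsOnPoints_meeting_affineOpen hsm U hU
      (Set.countable_range fun k => Z ∩ W Z k) ?_).mono fun Z' hZ' => ?_
    · rintro _ ⟨k, rfl⟩
      exact hZc.inter (hW₁ Z hZ hZU k).1
    · obtain ⟨⟨k, hk⟩, hZ'U⟩ := (hch Z Z').1 hZ'
      exact ⟨⟨Z ∩ W Z k, ⟨k, rfl⟩, hk⟩, hZ'U⟩
  -- (2) the levels `T m`
  obtain ⟨T, hT0, hTsucc⟩ : ∃ T : ℕ → Set (Set (ComplexPoints S)),
      T 0 = {Z | IsIrredComponentOnPoints S Set.univ Z ∧ ∃ y ∈ Z, y.pt ∈ U} ∧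
        ∀ m, T (m + 1) = ⋃ Z ∈ T m, children Z :=
    ⟨fun m => Nat.rec {Z | IsIrredComponentOnPoints S Set.univ Z ∧ ∃ y ∈ Z, y.pt ∈ U}
      (fun _ Tm => ⋃ Z ∈ Tm, children Z) m, rfl, fun _ => rfl⟩
  have hTgood : ∀ m, ∀ Z ∈ T m, IsIrreducibleZariskiClosedOnPoints S Z ∧ ∃ z ∈ Z, z.pt ∈ U := by
    intro m Z hZ
    cases m with
    | zero =>
      rw [hT0] at hZ
      exact ⟨hZ.1.1, hZ.2⟩
    | succ m =>
      rw [hTsucc] at hZ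
      obtain ⟨Z₀, -, hZ'⟩ := Set.mem_iUnion₂.1 hZ
      obtain ⟨⟨k, hk⟩, hZU⟩ := (hch Z₀ Z).1 hZ'
      exact ⟨hk.1, hZU⟩
  have hTc : ∀ m, (T m).Countable := by
    intro m
    induction m with
    | zero =>
      rw [hT0]
      exact (finite_irredComponentsOnPoints_meeting_affineOpen hsm U hU
        (isZariskiClosedOnPoints_univ S)).countable
    | succ m ih =>
      rw [hTsucc]
      exact ih.biUnion fun Z hZ => hchc Z (hTgood m Z hZ).1 (hTgood m Z hZ).2
  -- (3) descent: a special `Y` meeting `U` inside some `Z ∈ T m` lies in some `T m'`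
  have hdesc : ∀ Z : Set (ComplexPoints S), (∃ m, Z ∈ T m) → ∀ Y, D.IsSpecialSubvariety Y →
      (∃ y ∈ Y, y.pt ∈ U) → Y ⊆ Z → ∃ m, Y ∈ T m := by
    intro Z
    refine (wellFounded_ssubset_irreducibleZariskiClosedOnPoints hsm U hU).induction
      (C := fun Z => (∃ m, Z ∈ T m) → ∀ Y, D.IsSpecialSubvariety Y →
        (∃ y ∈ Y, y.pt ∈ U) → Y ⊆ Z → ∃ m, Y ∈ T m) Z ?_
    intro Z ih hZT Y hY hYU hYZ
    obtain ⟨m, hZm⟩ := hZT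
    obtain ⟨hZ, hZU⟩ := hTgood m Z hZm
    by_cases hne : Y = Z
    · subst hne
      exact ⟨m, hZm⟩
    obtain ⟨y, hy, hyU⟩ := hYU
    obtain ⟨k, Z', hZ', hYZ', hss⟩ := exists_child_of_isSpecialSubvariety D hbdd hZ (W Z)
      (hW₁ Z hZ hZU) (hW₂ Z hZ hZU) hY (hF2 Y hY.1 ⟨y, hy, hyU⟩) hYZ hne
    have hZ'T : Z' ∈ T (m + 1) := by
      rw [hTsucc]
      exact Set.mem_biUnion hZm ((hch Z Z').2 ⟨⟨k, hZ'⟩, y, hYZ' hy, hyU⟩)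
    exact ih Z' ⟨hss, hZ'.1, hZ, y, hYZ' hy, hyU⟩ ⟨m + 1, hZ'T⟩ Y hY ⟨y, hy, hyU⟩ hYZ'
  -- (4) conclusion: every special `Y` meeting `U` lies in a component of `S(ℂ)` meeting `U` (`∈ T 0`)
  refine (Set.countable_iUnion hTc).mono ?_
  rintro Y ⟨hY, y, hy, hyU⟩
  obtain ⟨Z₀, hZ₀, hYZ₀⟩ := exists_isIrredComponentOnPoints_superset
    (isZariskiClosedOnPoints_univ S) hY.1 (Set.subset_univ Y)
  have hZ₀T : Z₀ ∈ T 0 := by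
    rw [hT0]
    exact ⟨hZ₀, y, hYZ₀ hy, hyU⟩
  obtain ⟨m, hm⟩ := hdesc Z₀ ⟨0, hZ₀T⟩ Y hY ⟨y, hy, hyU⟩ hYZ₀
  exact Set.mem_iUnion.2 ⟨m, hm⟩

end Summit.HodgeConjecture.HodgeConjecture.Theorems

end
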